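import Mathlib
import Summits.AtomisticToContinuum.FouriersLaw.Theses.MatthiessenLadder
import Summits.AtomisticToContinuum.FouriersLaw.Theorems.JunctionLocalityHarmonicCalibration

/-!
# `MatthiessenLadder.LimitGlue` — proved

Item `stmt-AtomisticToContinuum-12781` (support, route `MatthiessenLadder`, sub-problem
`FouriersLaw`): `PrefixIncrementLimit → PrefixSteadyStates → BoundedResponseConverges`.

The proof is the telescoping ("Matthiessen ladder") argument of the route thesis. Fix parameters
`ω₂, lam, β, γ > 0`, a steady-state family `μ` of `pinnedChain ω₂ lam β γ`, `T > 0` and response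
limits `D N` along `μ`.

* `D N` is a response coefficient of the full prefix chain `cellChain (· < N)` at size `N`
  (`cellChain_const_true` + locality `cellChain_isResponseCoeff_congr`);
* `PrefixSteadyStates` supplies response coefficients `E k N` of every rung `cellChain (· < k)`;
  put `F N k := E k N` for `k < N` and `F N N := D N`, and resistances `R N k := (N-1)/F N k`;
* the base `k = 0` is the pinned HARMONIC chain (`cellChain_const_false`): uniqueness of its weak
  steady states (first clause of `PrefixSteadyStates` at `k = 0`) identifies every steady-state
  family with the Gaussian `harmonicNESS` (`isSteadyState_harmonicNESS`), whose total current is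
  `(N-1)·fluxCoeff ω₂ γ N·(T_L - T_R)` (`totalCurrent_harmonicNESS`), so `E 0 N = (N-1)·fluxCoeff`
  and `R N 0 = 1/fluxCoeff ω₂ γ N ≤ 2/fluxLimit ω₂ γ` is bounded;
* `PrefixIncrementLimit` bounds every increment `|R N (k+1) - R N k| ≤ rmax` (`N ≥ N₀`) and puts
  the bulk increments within `ε` of `r > 0`; summing, `R N N / N → r` (a Cesàro-type estimate,
  `tendsto_div_of_increments`), and `D N > 0` eventually;
* hence `D N = ((N-1)/N)/(R N N/N) → 1/r > 0`.

Neither the uniqueness hypothesis for the anharmonic chain nor the boundedness hypothesis of the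
slot is used. Sources: Bonetto–Lebowitz–Rey-Bellet 2000 §6.2 (Gaussian NESS of the harmonic
chain), Roy–Dhar 2008 eq. (2.8) (flux coefficient); all engines are PROVED tree facts.
-/

noncomputable section

open MeasureTheory Filter Topology

namespace Summit.AtomisticToContinuum.FouriersLaw.Theorems.MatthiessenLadder

open Literature.MathematicalPhysics.KineticTheory.HeatConduction

/-! ### A Cesàro-type lemma for telescoped increments -/

/-- **Averaging telescoped increments.** If a double sequence `a N k` has increments
`|a N (k+1) - a N k| ≤ rmax` for all `k < N` (`N ≥ N₀`), bulk increments within `ε` of `r`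
(`k₀ ≤ k`, `k + k₀ < N`, `N ≥ N₁(ε)`) and a bounded base `|a N 0| ≤ B`, then `a N N / N → r`.
[folklore] -/
theorem tendsto_div_of_increments {a : ℕ → ℕ → ℝ} {r rmax B : ℝ} {N₀ : ℕ}
    (hbd : ∀ N k : ℕ, N₀ ≤ N → k < N → |a N (k + 1) - a N k| ≤ rmax)
    (hbulk : ∀ ε : ℝ, 0 < ε → ∃ k₀ N₁ : ℕ, ∀ N k : ℕ, N₁ ≤ N → k₀ ≤ k → k + k₀ < N →
      |a N (k + 1) - a N k - r| ≤ ε)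
    (hbase : ∀ N : ℕ, N₀ ≤ N → |a N 0| ≤ B) :
    Tendsto (fun N : ℕ => a N N / N) atTop (𝓝 r) := by
  rw [Metric.tendsto_atTop]
  intro ε hε
  obtain ⟨k₀, N₁, hk₀⟩ := hbulk (ε / 2) (half_pos hε)
  set C : ℝ := |rmax| + |r| with hC
  have hC0 : 0 ≤ C := by positivity
  set K : ℝ := |B| + 2 * k₀ * C with hK
  have hK0 : 0 ≤ K := by positivity
  obtain ⟨M, hM⟩ := exists_nat_gt (2 * K / ε)
  refine ⟨max (max N₀ N₁) (max (2 * k₀ + 1) M), fun N hN => ?_⟩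
  have hN₀ : N₀ ≤ N := le_trans (le_max_left _ _) (le_trans (le_max_left _ _) hN)
  have hN₁ : N₁ ≤ N := le_trans (le_max_right _ _) (le_trans (le_max_left _ _) hN)
  have h2k : 2 * k₀ + 1 ≤ N := le_trans (le_max_left _ _) (le_trans (le_max_right _ _) hN)
  have hNM : M ≤ N := le_trans (le_max_right _ _) (le_trans (le_max_right _ _) hN)
  have hNpos : (0 : ℝ) < N := by exact_mod_cast (show 0 < N by omega)
  have hMN : (M : ℝ) ≤ N := by exact_mod_cast hNM
  -- telescoping
  have htel : ∑ k ∈ Finset.range N, (a N (k + 1) - a N k) = a N N - a N 0 :=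
    Finset.sum_range_sub (a N) N
  -- termwise bounds
  have hall : ∀ k, k < N → |a N (k + 1) - a N k - r| ≤ C := by
    intro k hk
    have h1 := hbd N k hN₀ hk
    have h2 := le_abs_self rmax
    calc |a N (k + 1) - a N k - r| ≤ |a N (k + 1) - a N k| + |r| := abs_sub _ _
      _ ≤ |rmax| + |r| := by linarith
  have hmid : ∀ k ∈ Finset.Ico k₀ (N - k₀), |a N (k + 1) - a N k - r| ≤ ε / 2 := by
    intro k hk
    rw [Finset.mem_Ico] at hk
    exact hk₀ N k hN₁ hk.1 (by omega)
  have hsumle : ∀ (s : Finset ℕ) (c : ℝ), (∀ k ∈ s, |a N (k + 1) - a N k - r| ≤ c) →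
      |∑ k ∈ s, (a N (k + 1) - a N k - r)| ≤ s.card * c := by
    intro s c h
    calc |∑ k ∈ s, (a N (k + 1) - a N k - r)| ≤ ∑ k ∈ s, |a N (k + 1) - a N k - r| :=
          Finset.abs_sum_le_sum_abs _ _
      _ ≤ ∑ _k ∈ s, c := Finset.sum_le_sum h
      _ = s.card * c := by rw [Finset.sum_const, nsmul_eq_mul]
  -- split the range into the two contact zones and the bulk
  set f : ℕ → ℝ := fun k => a N (k + 1) - a N k - r with hf
  have hsplit : ∑ k ∈ Finset.range N, f k =
      (∑ k ∈ Finset.Ico 0 k₀, f k) + (∑ k ∈ Finset.Ico k₀ (N - k₀), f k) +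
        ∑ k ∈ Finset.Ico (N - k₀) N, f k := by
    have e1 := Finset.sum_Ico_consecutive f (Nat.zero_le k₀) (show k₀ ≤ N by omega)
    have e2 := Finset.sum_Ico_consecutive f (show k₀ ≤ N - k₀ by omega)
      (show N - k₀ ≤ N by omega)
    rw [Finset.range_eq_Ico, ← e1, ← e2]
    ring
  have c1 : ((Finset.Ico 0 k₀).card : ℝ) = k₀ := by simp
  have c3 : ((Finset.Ico (N - k₀) N).card : ℝ) = k₀ := by
    have : (Finset.Ico (N - k₀) N).card = k₀ := by simp only [Nat.card_Ico]; omega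
    exact_mod_cast this
  have c2 : ((Finset.Ico k₀ (N - k₀)).card : ℝ) ≤ N := by
    have : (Finset.Ico k₀ (N - k₀)).card ≤ N := by simp only [Nat.card_Ico]; omega
    exact_mod_cast this
  have e1 := hsumle (Finset.Ico 0 k₀) C fun k hk => hall k (by rw [Finset.mem_Ico] at hk; omega)
  have e2 := hsumle (Finset.Ico k₀ (N - k₀)) (ε / 2) hmid
  have e3 := hsumle (Finset.Ico (N - k₀) N) C
    fun k hk => hall k (by rw [Finset.mem_Ico] at hk; omega)
  rw [c1] at e1
  rw [c3] at e3
  have hS : |∑ k ∈ Finset.range N, f k| ≤ 2 * k₀ * C + N * (ε / 2) := by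
    rw [hsplit]
    calc |(∑ k ∈ Finset.Ico 0 k₀, f k) + (∑ k ∈ Finset.Ico k₀ (N - k₀), f k) +
            ∑ k ∈ Finset.Ico (N - k₀) N, f k|
          ≤ |∑ k ∈ Finset.Ico 0 k₀, f k| + |∑ k ∈ Finset.Ico k₀ (N - k₀), f k| +
            |∑ k ∈ Finset.Ico (N - k₀) N, f k| := abs_add_three _ _ _
      _ ≤ k₀ * C + (Finset.Ico k₀ (N - k₀)).card * (ε / 2) + k₀ * C := by gcongr
      _ ≤ k₀ * C + N * (ε / 2) + k₀ * C := by gcongr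
      _ = 2 * k₀ * C + N * (ε / 2) := by ring
  -- combine
  have hmain : |a N N - N * r| ≤ K + N * (ε / 2) := by
    have e : a N N - N * r = a N 0 + ∑ k ∈ Finset.range N, f k := by
      simp only [hf]
      rw [Finset.sum_sub_distrib, htel, Finset.sum_const, Finset.card_range, nsmul_eq_mul]
      ring
    rw [e]
    calc |a N 0 + ∑ k ∈ Finset.range N, f k| ≤ |a N 0| + |∑ k ∈ Finset.range N, f k| :=
          abs_add_le _ _
      _ ≤ |B| + (2 * k₀ * C + N * (ε / 2)) :=
          add_le_add ((hbase N hN₀).trans (le_abs_self B)) hS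
      _ = K + N * (ε / 2) := by rw [hK]; ring
  have e2 : (a N N - N * r) / N = a N N / N - r := by
    rw [sub_div, mul_div_cancel_left₀ r hNpos.ne']
  rw [Real.dist_eq, ← e2, abs_div, abs_of_pos hNpos, div_lt_iff₀ hNpos]
  have hKM : K < M * (ε / 2) := by
    have := (div_lt_iff₀ hε).mp hM
    linarith
  have hMN' : (M : ℝ) * (ε / 2) ≤ N * (ε / 2) :=
    mul_le_mul_of_nonneg_right hMN (by positivity)
  calc |a N N - N * r| ≤ K + N * (ε / 2) := hmain
    _ < M * (ε / 2) + N * (ε / 2) := by linarith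
    _ ≤ N * (ε / 2) + N * (ε / 2) := by linarith
    _ = ε * N := by ring

/-! ### The rungs `k = 0` and `k = N` of the prefix ladder -/

section Rungs

variable (ω₂ lam β γ : ℝ)

/-- The rung `k = 0` (no cell switched on) has the steady states of the pinned harmonic chain
`pinnedChain ω₂ 0 0 γ` (locality + `cellChain_const_false`). [folklore] -/
theorem cellChain_lt_zero_isSteadyState (N : ℕ) :
    (cellChain ω₂ lam β γ (fun i => decide (i < 0))).IsSteadyState N =
      (pinnedChain ω₂ 0 0 γ).IsSteadyState N := by
  rw [cellChain_isSteadyState_congr ω₂ lam β γ (c' := fun _ => false) (fun i _ => by simp),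
    cellChain_const_false, OscillatorChain.toSiteChain_isSteadyState]

/-- The rung `k = 0` has the response coefficients of the pinned harmonic chain. [folklore] -/
theorem cellChain_lt_zero_isResponseCoeff (N : ℕ) :
    (cellChain ω₂ lam β γ (fun i => decide (i < 0))).IsResponseCoeff N =
      (pinnedChain ω₂ 0 0 γ).toSiteChain.IsResponseCoeff N := by
  rw [cellChain_isResponseCoeff_congr ω₂ lam β γ (c' := fun _ => false) (fun i _ => by simp),
    cellChain_const_false]

/-- The rung `k = N` at size `N` (all cells switched on) has the response coefficients of the
conjunct's chain `pinnedChain ω₂ lam β γ` (locality + `cellChain_const_true`). [folklore] -/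
theorem cellChain_lt_self_isResponseCoeff (N : ℕ) :
    (cellChain ω₂ lam β γ (fun i => decide (i < N))).IsResponseCoeff N =
      (pinnedChain ω₂ lam β γ).toSiteChain.IsResponseCoeff N := by
  rw [cellChain_isResponseCoeff_congr ω₂ lam β γ (c' := fun _ => true)
    (fun i hi => by simp [hi]), cellChain_const_true]

end Rungs

/-- **The harmonic base of the ladder.** If the weak steady states of the pinned harmonic chain
`pinnedChain ω₂ 0 0 γ` at size `N` are all equal to the Gaussian `harmonicNESS`, then every
response coefficient at `T > 0` equals `(N - 1) · fluxCoeff ω₂ γ N`: the difference quotient is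
constant on `0 < |δ| < 2T` (`totalCurrent_harmonicNESS`). [cite: BonettoLebowitzReyBellet2000, §6.2] -/
theorem responseCoeff_harmonic_eq {ω₂ γ : ℝ} (hω : 0 < ω₂) (hγ : 0 < γ) {N : ℕ} {T D : ℝ}
    (hT : 0 < T)
    (huniq : ∀ T_L T_R : ℝ, 0 < T_L → 0 < T_R → ∀ ν : Measure (PhaseSpace N),
      (pinnedChain ω₂ 0 0 γ).IsSteadyState N T_L T_R ν → ν = harmonicNESS ω₂ γ N T_L T_R)
    (hD : (pinnedChain ω₂ 0 0 γ).toSiteChain.IsResponseCoeff N T D) :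
    D = ((N : ℝ) - 1) * fluxCoeff ω₂ γ N := by
  obtain ⟨ν, hν, hlim⟩ := hD
  simp only [OscillatorChain.toSiteChain_isSteadyState] at hν
  simp only [OscillatorChain.toSiteChain_totalCurrent] at hlim
  have hconst : ∀ᶠ δ in 𝓝[≠] (0 : ℝ),
      (pinnedChain ω₂ 0 0 γ).totalCurrent (ν (T + δ / 2) (T - δ / 2)) / δ =
        ((N : ℝ) - 1) * fluxCoeff ω₂ γ N := by
    have h2 : ∀ᶠ δ in 𝓝 (0 : ℝ), δ < 2 * T := eventually_lt_nhds (by linarith)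
    have h2' : ∀ᶠ δ in 𝓝 (0 : ℝ), -(2 * T) < δ := eventually_gt_nhds (by linarith)
    have hne : ∀ᶠ δ in 𝓝[≠] (0 : ℝ), δ ≠ 0 := eventually_mem_nhdsWithin
    filter_upwards [mem_nhdsWithin_of_mem_nhds h2, mem_nhdsWithin_of_mem_nhds h2', hne]
      with δ hlt hgt hδ
    have ha : 0 < T + δ / 2 := by linarith
    have hb : 0 < T - δ / 2 := by linarith
    have e : T + δ / 2 - (T - δ / 2) = δ := by ring
    rw [huniq _ _ ha hb _ (hν _ _ ha hb), JunctionLocality.totalCurrent_harmonicNESS hω hγ N ha hb,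
      e, mul_div_assoc, div_self hδ, mul_one]
  have hlim' : Tendsto (fun δ : ℝ =>
      (pinnedChain ω₂ 0 0 γ).totalCurrent (ν (T + δ / 2) (T - δ / 2)) / δ) (𝓝[≠] 0)
      (𝓝 (((N : ℝ) - 1) * fluxCoeff ω₂ γ N)) :=
    tendsto_const_nhds.congr' (hconst.mono fun δ hδ => hδ.symm)
  exact tendsto_nhds_unique hlim hlim'

/-- **`MatthiessenLadder.LimitGlue`, PROVED** (item stmt-AtomisticToContinuum-12781):
`PrefixIncrementLimit → PrefixSteadyStates → BoundedResponseConverges`. Telescoping the prefix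
ladder from the solved harmonic base: `(N-1)/D N = 1/fluxCoeff ω₂ γ N + ∑_{k<N} Δ_{N,k}` with
`|Δ_{N,k}| ≤ rmax` and bulk increments `→ r > 0`, so `(N-1)/(N · D N) → r` and `D N → 1/r`.
[cite: BonettoLebowitzReyBellet2000, §6.2] -/
theorem limitGlue_proof :
    Summit.AtomisticToContinuum.FouriersLaw.Theses.MatthiessenLadder.LimitGlue := by
  unfold Summit.AtomisticToContinuum.FouriersLaw.Theses.MatthiessenLadder.LimitGlue
  intro hPIL hPSS
  unfold Summit.AtomisticToContinuum.FouriersLaw.Theses.MatthiessenLadder.BoundedResponseConverges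
  intro ω₂ lam β γ hω hl hβ hγ _ μ hμ T hT D hD _
  have hPSS' := hPSS ω₂ lam β γ hω hl hβ hγ
  obtain ⟨r, rmax, hr, -, N₀, hbd, hbulk⟩ := hPIL ω₂ lam β γ hω hl hβ hγ T hT
  -- Step 1: `D N` is a response coefficient of the full prefix chain `cellChain (· < N)` at size `N`
  have hDN : ∀ N : ℕ,
      (cellChain ω₂ lam β γ (fun i => decide (i < N))).IsResponseCoeff N T (D N) := by
    intro N
    rw [cellChain_lt_self_isResponseCoeff]
    refine ⟨μ N, ?_, ?_⟩
    · simpa only [OscillatorChain.toSiteChain_isSteadyState] using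
        fun T_L T_R h1 h2 => hμ N T_L T_R h1 h2
    · simpa only [OscillatorChain.toSiteChain_totalCurrent] using hD N
  -- Step 2: response coefficients of all rungs
  choose E hE using fun k N => (hPSS' k).2 N T hT
  obtain ⟨F, hFdef⟩ : ∃ F : ℕ → ℕ → ℝ, F = fun N k : ℕ => if k < N then E k N else D N :=
    ⟨_, rfl⟩
  have hF : ∀ N k : ℕ, k ≤ N →
      (cellChain ω₂ lam β γ (fun i => decide (i < k))).IsResponseCoeff N T (F N k) := by
    intro N k hk
    by_cases hlt : k < N
    · rw [hFdef]
      simp only [if_pos hlt]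
      exact hE k N
    · obtain rfl : k = N := le_antisymm hk (not_lt.mp hlt)
      rw [hFdef]
      simp only [lt_irrefl, if_false]
      exact hDN k
  have hFN : ∀ N : ℕ, F N N = D N := fun N => by rw [hFdef]; simp
  -- Step 3: the harmonic base `E 0 N = (N-1) · fluxCoeff ω₂ γ N`
  have hE0 : ∀ N : ℕ, E 0 N = ((N : ℝ) - 1) * fluxCoeff ω₂ γ N := by
    intro N
    have huniq : ∀ T_L T_R : ℝ, 0 < T_L → 0 < T_R → ∀ ν : Measure (PhaseSpace N),
        (pinnedChain ω₂ 0 0 γ).IsSteadyState N T_L T_R ν → ν = harmonicNESS ω₂ γ N T_L T_R := by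
      intro T_L T_R h1 h2 ν hν
      obtain ⟨μ₀, -, hu⟩ := (hPSS' 0).1 N T_L T_R h1 h2
      rw [cellChain_lt_zero_isSteadyState] at hu
      rw [hu ν hν, hu _ (isSteadyState_harmonicNESS hω hγ N h1 h2)]
    have h0 := hE 0 N
    rw [cellChain_lt_zero_isResponseCoeff] at h0
    exact responseCoeff_harmonic_eq hω hγ hT huniq h0
  -- the resistances `R N k = (N-1)/F N k`
  obtain ⟨R, hRdef⟩ : ∃ R : ℕ → ℕ → ℝ, R = fun N k : ℕ => ((N : ℝ) - 1) / F N k := ⟨_, rfl⟩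
  have hbd' : ∀ N k : ℕ, max N₀ 2 ≤ N → k < N → |R N (k + 1) - R N k| ≤ rmax := by
    intro N k hN hk
    rw [hRdef]
    exact (hbd N k (le_of_max_le_left hN) hk (F N k) (F N (k + 1)) (hF N k hk.le)
      (hF N (k + 1) (Nat.succ_le_of_lt hk))).2.2
  have hbulk' : ∀ ε : ℝ, 0 < ε → ∃ k₀ N₁ : ℕ, ∀ N k : ℕ, N₁ ≤ N → k₀ ≤ k → k + k₀ < N →
      |R N (k + 1) - R N k - r| ≤ ε := by
    intro ε hε
    obtain ⟨k₀, N₁, h⟩ := hbulk ε hε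
    refine ⟨k₀, N₁, fun N k hN hk hkN => ?_⟩
    rw [hRdef]
    exact h N k hN hk hkN (F N k) (F N (k + 1)) (hF N k (by omega)) (hF N (k + 1) (by omega))
  have hbase : ∀ N : ℕ, max N₀ 2 ≤ N → |R N 0| ≤ 2 / fluxLimit ω₂ γ := by
    intro N hN
    have h2 : 2 ≤ N := le_of_max_le_right hN
    have h2' : (2 : ℝ) ≤ N := by exact_mod_cast h2
    have hF0 : F N 0 = ((N : ℝ) - 1) * fluxCoeff ω₂ γ N := by
      rw [hFdef]
      simp only [if_pos (show 0 < N by omega)]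
      exact hE0 N
    have hc := JunctionLocality.fluxCoeff_pos hω hγ (show 1 < N by omega)
    rw [hRdef]
    simp only [hF0]
    rw [div_mul_eq_div_div, div_self (by linarith : ((N : ℝ) - 1) ≠ 0),
      abs_of_pos (one_div_pos.mpr hc)]
    exact JunctionLocality.one_div_fluxCoeff_le hω hγ (by omega)
  -- Step 4: `R N N / N → r`
  have hlim : Tendsto (fun N : ℕ => R N N / N) atTop (𝓝 r) :=
    tendsto_div_of_increments hbd' hbulk' hbase
  -- Step 5: positivity of `D N` for `N ≥ max N₀ 2`
  have hDpos : ∀ N : ℕ, max N₀ 2 ≤ N → 0 < D N := by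
    intro N hN
    obtain ⟨M, rfl⟩ : ∃ M, N = M + 1 := ⟨N - 1, by omega⟩
    have h := (hbd (M + 1) M (le_of_max_le_left hN) (Nat.lt_succ_self M) (F (M + 1) M)
      (F (M + 1) (M + 1)) (hF _ _ (Nat.le_succ M)) (hF _ _ le_rfl)).2.1
    rwa [hFN] at h
  -- Step 6: `D N = ((N-1)/N) / (R N N / N) → 1 / r`
  refine ⟨1 / r, by positivity, ?_⟩
  have h1 : Tendsto (fun N : ℕ => ((N : ℝ) - 1) / N) atTop (𝓝 1) := by
    have h := (tendsto_const_nhds : Tendsto (fun _ : ℕ => (1 : ℝ)) atTop (𝓝 1)).sub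
      (tendsto_one_div_atTop_nhds_zero_nat (𝕜 := ℝ))
    rw [sub_zero] at h
    refine h.congr' ?_
    filter_upwards [eventually_ge_atTop 1] with N hN
    have hN' : (N : ℝ) ≠ 0 := by exact_mod_cast (show N ≠ 0 by omega)
    rw [sub_div, div_self hN']
  have h2 := h1.div hlim hr.ne'
  refine h2.congr' ?_
  filter_upwards [eventually_ge_atTop (max N₀ 2)] with N hN
  have hDp := hDpos N hN
  have h2' : (2 : ℝ) ≤ N := by exact_mod_cast le_of_max_le_right hN
  have hN0 : (N : ℝ) ≠ 0 := (by linarith : (0 : ℝ) < N).ne'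
  have hN1 : (N : ℝ) - 1 ≠ 0 := (by linarith : (0 : ℝ) < N - 1).ne'
  simp only [Pi.div_apply, hRdef, hFN]
  field_simp
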